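import Summits.AtomisticToContinuum.Crystallization.Theorems.OverbindingBudgetAffineFarFieldCellRD

/-!
# OverbindingBudget (2c) — part 27Vb-K(B1): the half-twist and the symmetries of the ideal `h`-cell (lens-4 g95; r1673/r1681 S3 «27Vb-K ideal cells», ed.2 split)

Support file, pure analysis on `ℝ³ = EuclideanSpace ℝ (Fin 3)`, no atlas.  The GEOMETRY behind the
reference cell of an hcp (`h`-letter) site (part 27Vb-K(B2) `…FarFieldCellTRD` builds the cell
`trdCell h := Ψ⁻¹(rdCell h)` on it), in the cubic frame of the tree's hcp convention (in-plane
neighbours `(1,-1,0)`-type, UPPER cap `(1,1,0)`-type, LOWER cap `(-1,-1,-4)/3`-type):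

* `axSumL` — the axial coordinate `x ↦ x₀+x₁+x₂` as a continuous linear functional;
* `halfTurn` — the rotation by `π` about the stacking axis `(1,1,1)`, `v ↦ (2/3)(Σv)(1,1,1) - v`:
  a linear isometry, an involution, preserves `Σv`, equals `v ↦ -v` on the basal plane `Σv = 0`,
  commutes with the coordinate 3-cycle `cycIso` of part (161);
* `halfTwist` (`Ψ`) — the identity on `{Σx ≥ 0}` and `halfTurn` on `{Σx < 0}`: a measurable,
  MEASURE-PRESERVING involution of `ℝ³` (`measurePreserving_halfTwist`) with `‖Ψx‖ = ‖x‖` and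
  `Σ(Ψx) = Σx` pointwise, commuting with the 3-cycle and with positive scalings (`halfTwist_smul`);
  change of variables `∫_{Ψ⁻¹ S} g = ∫_S g ∘ Ψ` (`setIntegral_preimage_halfTwist`);
* two facts about the `k`-cell `rdCell h` of part 27Vb-K(A) used downstream (`x ↦ -x` symmetry,
  radial scaling into itself, centroid `0`, vanishing off-diagonal second moments);
* `swapIso` — the coordinate transposition `(v₀,v₁,v₂) ↦ (v₁,v₀,v₂)` (a mirror containing the stacking
  axis; preserves `Σv`, commutes with `halfTurn` and `Ψ`, leaves `rdCell h` invariant) and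
  `basalRefl := -halfTurn` — the reflection in the basal plane (negates `Σv`).  With the 3-cycle these
  generate the `D₃ₕ` point group of the trapezo-rhombic dodecahedron; part (B2) uses the 3-cycle for the
  centroid and second moments, part 27Vb-K(C) uses all three for the cubic tensor.
-/

namespace Summit.AtomisticToContinuum.Crystallization.Theorems.OverbindingBudgetAffineFarFieldCellTwist

noncomputable section

open MeasureTheory Set
open scoped Pointwise
open Summit.AtomisticToContinuum.Crystallization.Theorems.OverbindingBudgetAffineFarFieldCellTaylor
open Summit.AtomisticToContinuum.Crystallization.Theorems.OverbindingBudgetAffineFarFieldCellSymm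
open Summit.AtomisticToContinuum.Crystallization.Theorems.OverbindingBudgetAffineFarFieldCellRD

local notation "E3" => EuclideanSpace ℝ (Fin 3)

/-! ### The axial coordinate and the half-turn about the stacking axis `(1,1,1)` -/

/-- support: the axial coordinate `x₀ + x₁ + x₂` (`= √3 ×` the height along the stacking axis `(1,1,1)/√3`),
as a continuous linear functional. -/
def axSumL : E3 →L[ℝ] ℝ := EuclideanSpace.proj 0 + EuclideanSpace.proj 1 + EuclideanSpace.proj 2

/-- The axial functional is the coordinate sum `x₀ + x₁ + x₂`. -/
theorem axSumL_apply (x : E3) : axSumL x = x 0 + x 1 + x 2 := by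
  simp [axSumL]

/-- support: the half-turn (rotation by `π`) about the stacking axis `(1,1,1)`:
`v ↦ (2/3)(v₀+v₁+v₂)·(1,1,1) - v`, as a linear map. -/
def halfTurnLin : E3 →ₗ[ℝ] E3 where
  toFun v := ((2 / 3 : ℝ) * axSumL v) • (e3 0 + e3 1 + e3 2) - v
  map_add' u v := by
    rw [map_add, mul_add, add_smul]
    abel
  map_smul' c v := by
    rw [map_smul, smul_eq_mul, RingHom.id_apply, smul_sub, smul_smul]
    ring_nf

/-- Coordinates of the half-turn: `(ρ v)_i = (2/3)(v₀+v₁+v₂) - v_i`. -/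
theorem halfTurnLin_apply (v : E3) (i : Fin 3) :
    halfTurnLin v i = 2 / 3 * (v 0 + v 1 + v 2) - v i := by
  simp only [halfTurnLin, LinearMap.coe_mk, AddHom.coe_mk, PiLp.sub_apply, PiLp.smul_apply,
    PiLp.add_apply, e3_apply, smul_eq_mul, axSumL_apply]
  fin_cases i <;> simp

/-- The half-turn preserves the axial coordinate. -/
theorem axSum_halfTurnLin (v : E3) :
    halfTurnLin v 0 + halfTurnLin v 1 + halfTurnLin v 2 = v 0 + v 1 + v 2 := by
  simp only [halfTurnLin_apply]; ring

/-- The half-turn is an involution. -/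
theorem halfTurnLin_involutive : Function.Involutive halfTurnLin := by
  intro v
  ext i
  rw [halfTurnLin_apply, axSum_halfTurnLin, halfTurnLin_apply]
  ring

/-- The half-turn preserves the Euclidean norm. -/
theorem norm_halfTurnLin (v : E3) : ‖halfTurnLin v‖ = ‖v‖ := by
  have h2 : ‖halfTurnLin v‖ ^ 2 = ‖v‖ ^ 2 := by
    rw [EuclideanSpace.real_norm_sq_eq, EuclideanSpace.real_norm_sq_eq, Fin.sum_univ_three,
      Fin.sum_univ_three]
    simp only [halfTurnLin_apply]
    ring
  exact (sq_eq_sq₀ (norm_nonneg _) (norm_nonneg _)).1 h2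

/-- support: the half-turn about the stacking axis as a linear isometry equivalence. -/
def halfTurn : E3 ≃ₗᵢ[ℝ] E3 :=
  { LinearEquiv.ofInvolutive halfTurnLin halfTurnLin_involutive with
    norm_map' := norm_halfTurnLin }

/-- Pointwise formula of the half-turn: `(2/3)(Σv)·(1,1,1) - v`. -/
@[simp] theorem halfTurn_apply (v : E3) (i : Fin 3) :
    halfTurn v i = 2 / 3 * (v 0 + v 1 + v 2) - v i := halfTurnLin_apply v i

/-- The half-turn preserves the axial coordinate. -/
@[simp] theorem axSumL_halfTurn (v : E3) : axSumL (halfTurn v) = axSumL v := by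
  simp only [axSumL_apply, halfTurn_apply]; ring

/-- The half-turn is its own inverse (pointwise). -/
@[simp] theorem halfTurn_halfTurn (v : E3) : halfTurn (halfTurn v) = v :=
  halfTurnLin_involutive v

/-- The half-turn commutes with the coordinate 3-cycle. -/
theorem halfTurn_cycIso (v : E3) : halfTurn (cycIso v) = cycIso (halfTurn v) := by
  ext i
  fin_cases i <;>
    simp [halfTurn_apply, cycIso_apply_zero, cycIso_apply_one, cycIso_apply_two] <;> ring

/-- The half-turn commutes with the inverse coordinate 3-cycle. -/
theorem halfTurn_cycIso_symm (v : E3) : halfTurn (cycIso.symm v) = cycIso.symm (halfTurn v) := by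
  ext i
  fin_cases i <;>
    simp [halfTurn_apply, cycIso_symm_apply_zero, cycIso_symm_apply_one, cycIso_symm_apply_two] <;>
    ring

/-- On the basal plane `x₀+x₁+x₂ = 0` the half-turn is `v ↦ -v`. -/
theorem halfTurn_of_axSum_zero {v : E3} (hv : axSumL v = 0) : halfTurn v = -v := by
  ext i
  rw [axSumL_apply] at hv
  rw [halfTurn_apply, hv, PiLp.neg_apply]
  ring

/-! ### The half-twist `Ψ` (identity above the basal plane, half-turn below) -/

/-- support: the HALF-TWIST — the identity on the closed upper half-space `0 ≤ x₀+x₁+x₂` and the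
half-turn about the stacking axis on the open lower half-space; a measure-preserving involution of `ℝ³`
preserving norms and the axial coordinate. -/
def halfTwist (x : E3) : E3 := if 0 ≤ axSumL x then x else halfTurn x

/-- Above (and on) the basal plane the half-twist is the identity. -/
theorem halfTwist_of_nonneg {x : E3} (hx : 0 ≤ axSumL x) : halfTwist x = x := if_pos hx

/-- Strictly below the basal plane the half-twist is the half-turn. -/
theorem halfTwist_of_neg {x : E3} (hx : axSumL x < 0) : halfTwist x = halfTurn x := if_neg (not_le.2 hx)

/-- The half-twist preserves the axial coordinate `Σx`. -/
@[simp] theorem axSumL_halfTwist (x : E3) : axSumL (halfTwist x) = axSumL x := by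
  by_cases hx : 0 ≤ axSumL x
  · rw [halfTwist_of_nonneg hx]
  · rw [halfTwist_of_neg (not_le.1 hx), axSumL_halfTurn]

/-- The half-twist preserves the norm. -/
@[simp] theorem norm_halfTwist (x : E3) : ‖halfTwist x‖ = ‖x‖ := by
  by_cases hx : 0 ≤ axSumL x
  · rw [halfTwist_of_nonneg hx]
  · rw [halfTwist_of_neg (not_le.1 hx), LinearIsometryEquiv.norm_map]

/-- The half-twist is an involution. -/
@[simp] theorem halfTwist_halfTwist (x : E3) : halfTwist (halfTwist x) = x := by
  by_cases hx : 0 ≤ axSumL x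
  · rw [halfTwist_of_nonneg hx, halfTwist_of_nonneg hx]
  · have hx' : axSumL x < 0 := not_le.1 hx
    rw [halfTwist_of_neg hx', halfTwist_of_neg (by rwa [axSumL_halfTurn]), halfTurn_halfTurn]

/-- The half-twist commutes with the coordinate 3-cycle. -/
theorem halfTwist_cycIso (x : E3) : halfTwist (cycIso x) = cycIso (halfTwist x) := by
  have hs : axSumL (cycIso x) = axSumL x := by
    simp only [axSumL_apply, cycIso_apply_zero, cycIso_apply_one, cycIso_apply_two]; ring
  by_cases hx : 0 ≤ axSumL x
  · rw [halfTwist_of_nonneg hx, halfTwist_of_nonneg (by rwa [hs])]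
  · have hx' : axSumL x < 0 := not_le.1 hx
    rw [halfTwist_of_neg hx', halfTwist_of_neg (by rwa [hs]), halfTurn_cycIso]

/-- The half-twist commutes with the inverse coordinate 3-cycle. -/
theorem halfTwist_cycIso_symm (x : E3) : halfTwist (cycIso.symm x) = cycIso.symm (halfTwist x) := by
  have hs : axSumL (cycIso.symm x) = axSumL x := by
    simp only [axSumL_apply, cycIso_symm_apply_zero, cycIso_symm_apply_one, cycIso_symm_apply_two]
    ring
  by_cases hx : 0 ≤ axSumL x
  · rw [halfTwist_of_nonneg hx, halfTwist_of_nonneg (by rwa [hs])]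
  · have hx' : axSumL x < 0 := not_le.1 hx
    rw [halfTwist_of_neg hx', halfTwist_of_neg (by rwa [hs]), halfTurn_cycIso_symm]

/-- The closed upper half-space `{Σx ≥ 0}` is measurable. -/
theorem measurableSet_upper : MeasurableSet {x : E3 | 0 ≤ axSumL x} :=
  measurableSet_le measurable_const axSumL.continuous.measurable

/-- The half-twist is measurable (piecewise continuous on a measurable partition). -/
theorem measurable_halfTwist : Measurable halfTwist :=
  Measurable.ite measurableSet_upper measurable_id halfTurn.continuous.measurable

/-- The half-twist as a measurable equivalence (it is its own inverse). -/
def halfTwistEquiv : E3 ≃ᵐ E3 where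
  toFun := halfTwist
  invFun := halfTwist
  left_inv := halfTwist_halfTwist
  right_inv := halfTwist_halfTwist
  measurable_toFun := measurable_halfTwist
  measurable_invFun := measurable_halfTwist

/-- The half-twist is a measurable embedding (it is a measurable involution). -/
theorem measurableEmbedding_halfTwist : MeasurableEmbedding halfTwist :=
  halfTwistEquiv.measurableEmbedding

/-- The half-twist preserves Lebesgue measure (it is an isometry on each of two complementary
invariant half-spaces). -/
theorem measurePreserving_halfTwist : MeasurePreserving halfTwist (volume : Measure E3) volume := by
  refine ⟨measurable_halfTwist, ?_⟩
  ext A hA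
  rw [Measure.map_apply measurable_halfTwist hA]
  set H : Set E3 := {x | 0 ≤ axSumL x} with hH
  have hHm : MeasurableSet H := measurableSet_upper
  have hpre : halfTwist ⁻¹' A = (A ∩ H) ∪ halfTurn ⁻¹' (A \ H) := by
    ext x
    simp only [mem_preimage, mem_union, mem_inter_iff, mem_sdiff, hH, mem_setOf_eq, axSumL_halfTurn]
    by_cases hx : 0 ≤ axSumL x
    · rw [halfTwist_of_nonneg hx]
      constructor
      · intro h; exact Or.inl ⟨h, hx⟩
      · rintro (⟨h, -⟩ | ⟨-, h⟩)
        · exact h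
        · exact absurd hx h
    · rw [halfTwist_of_neg (not_le.1 hx)]
      constructor
      · intro h; exact Or.inr ⟨h, hx⟩
      · rintro (⟨-, h⟩ | ⟨h, -⟩)
        · exact absurd h hx
        · exact h
  have hdisj : Disjoint (A ∩ H) (halfTurn ⁻¹' (A \ H)) := by
    rw [Set.disjoint_left]
    rintro x ⟨-, hxH⟩ ⟨-, hxH'⟩
    apply hxH'
    show 0 ≤ axSumL (halfTurn x)
    rw [axSumL_halfTurn]
    exact hxH
  rw [hpre, measure_union hdisj (halfTurn.continuous.measurable (hA.diff hHm)),
    halfTurn.measurePreserving.measure_preimage (hA.diff hHm).nullMeasurableSet,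
    measure_inter_add_sdiff A hHm]

/-- Change of variables under the half-twist: `∫_{Ψ⁻¹ S} g ∘ Ψ = ∫_S g`. -/
theorem setIntegral_preimage_halfTwist {F : Type*} [NormedAddCommGroup F] [NormedSpace ℝ F]
    (g : E3 → F) (S : Set E3) :
    ∫ x in halfTwist ⁻¹' S, g (halfTwist x) = ∫ y in S, g y :=
  measurePreserving_halfTwist.setIntegral_preimage_emb measurableEmbedding_halfTwist g S

/-! ### Scaling, and two more facts about the `k`-cell -/

/-- The half-twist commutes with scaling by a nonnegative factor. -/
theorem halfTwist_smul {c : ℝ} (hc : 0 < c) (x : E3) : halfTwist (c • x) = c • halfTwist x := by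
  have hs : axSumL (c • x) = c * axSumL x := by rw [map_smul, smul_eq_mul]
  by_cases hx : 0 ≤ axSumL x
  · rw [halfTwist_of_nonneg hx, halfTwist_of_nonneg (by rw [hs]; positivity)]
  · have hx' : axSumL x < 0 := not_le.1 hx
    rw [halfTwist_of_neg hx', halfTwist_of_neg (by rw [hs]; exact mul_neg_of_pos_of_neg hc hx'),
      map_smul]

/-- `rdCell h` is symmetric under `x ↦ -x`. -/
theorem neg_mem_rdCell_iff {h : ℝ} {x : E3} : -x ∈ rdCell h ↔ x ∈ rdCell h := by
  simp only [mem_rdCell, PiLp.neg_apply, abs_neg]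

/-- Scaling by `b ∈ [0,1]` keeps points of `rdCell h` inside. -/
theorem smul_mem_rdCell {h : ℝ} {z : E3} (hz : z ∈ rdCell h) {b : ℝ} (hb0 : 0 ≤ b) (hb1 : b ≤ 1) :
    b • z ∈ rdCell h := by
  rw [mem_rdCell] at hz ⊢
  intro i j hij
  have hzij := hz i j hij
  simp only [PiLp.smul_apply, smul_eq_mul, abs_mul, abs_of_nonneg hb0]
  have hs : 0 ≤ |z i| + |z j| := by positivity
  nlinarith

/-- The centroid of `rdCell h` is the origin (vector form). -/
theorem integral_id_rdCell (h : ℝ) : ∫ x in rdCell h, x = 0 := by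
  simpa using integral_sub_eq_zero (isCentrallySymmetric_rdCell h)

/-- The off-diagonal second moments of `rdCell h` vanish (flip symmetry). -/
theorem offdiag_rdCell (h : ℝ) {i j : Fin 3} (hij : i ≠ j) : ∫ x in rdCell h, x i * x j = 0 := by
  simpa using moment_offdiag_eq_zero hij (rdCell_invariant_flip h i)

/-! ### The coordinate swap and the basal reflection (with the 3-cycle: the `D₃ₕ` symmetry of the `h`-cell) -/

/-- support: the coordinate transposition `(v₀, v₁, v₂) ↦ (v₁, v₀, v₂)` (a mirror of the `h`-cell
containing the stacking axis). -/
def swapIso : E3 ≃ₗᵢ[ℝ] E3 := LinearIsometryEquiv.piLpCongrLeft 2 ℝ ℝ (Equiv.swap (0 : Fin 3) 1)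

/-- Pointwise formula of the coordinate swap: `(swapIso v) i = v (swap 0 1 i)`. -/
theorem swapIso_apply (v : E3) (i : Fin 3) : swapIso v i = v (Equiv.swap (0 : Fin 3) 1 i) := by
  simp [swapIso, LinearIsometryEquiv.piLpCongrLeft_apply, Equiv.piCongrLeft'_apply]

/-- Pointwise formula of the inverse coordinate swap. -/
theorem swapIso_symm_apply (v : E3) (i : Fin 3) : swapIso.symm v i = v (Equiv.swap (0 : Fin 3) 1 i) := by
  simp [swapIso, LinearIsometryEquiv.piLpCongrLeft_apply, Equiv.piCongrLeft'_apply]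

/-- The coordinate swap is its own inverse. -/
theorem swapIso_symm : swapIso.symm = swapIso := by
  ext v i
  rw [swapIso_symm_apply, swapIso_apply]

/-- Coordinate `0` of the swapped vector is coordinate `1`. -/
@[simp] theorem swapIso_apply_zero (v : E3) : swapIso v 0 = v 1 := by
  rw [swapIso_apply, Equiv.swap_apply_left]
/-- Coordinate `1` of the swapped vector is coordinate `0`. -/
@[simp] theorem swapIso_apply_one (v : E3) : swapIso v 1 = v 0 := by
  rw [swapIso_apply, Equiv.swap_apply_right]
/-- Coordinate `2` is fixed by the swap. -/
@[simp] theorem swapIso_apply_two (v : E3) : swapIso v 2 = v 2 := by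
  rw [swapIso_apply, Equiv.swap_apply_of_ne_of_ne (by decide) (by decide)]

/-- The `k`-cell is invariant under the coordinate swap (about the site `0`). -/
theorem rdCell_invariant_swap (h : ℝ) : IsInvariantUnder (rdCell h) 0 swapIso := by
  intro x hx
  rw [sub_zero, zero_add, mem_rdCell]
  intro i j hij
  rw [swapIso_apply, swapIso_apply]
  exact (mem_rdCell.1 hx) _ _ (fun e => hij ((Equiv.swap (0 : Fin 3) 1).injective e))

/-- The coordinate swap preserves the axial coordinate `Σx`. -/
theorem axSumL_swapIso (v : E3) : axSumL (swapIso v) = axSumL v := by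
  rw [axSumL_apply, axSumL_apply, swapIso_apply_zero, swapIso_apply_one, swapIso_apply_two]; ring

/-- The half-turn commutes with the coordinate swap. -/
theorem halfTurn_swapIso (v : E3) : halfTurn (swapIso v) = swapIso (halfTurn v) := by
  ext i
  fin_cases i <;> simp [halfTurn_apply] <;> ring

/-- The half-twist commutes with the coordinate swap. -/
theorem halfTwist_swapIso (x : E3) : halfTwist (swapIso x) = swapIso (halfTwist x) := by
  by_cases hx : 0 ≤ axSumL x
  · rw [halfTwist_of_nonneg hx, halfTwist_of_nonneg (by rwa [axSumL_swapIso])]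
  · have hx' : axSumL x < 0 := not_le.1 hx
    rw [halfTwist_of_neg hx', halfTwist_of_neg (by rwa [axSumL_swapIso]), halfTurn_swapIso]


/-- support: the BASAL REFLECTION — the reflection in the basal plane `x₀+x₁+x₂ = 0`, `v ↦ -halfTurn v`
(the horizontal mirror of the `h`-cell). -/
def basalRefl : E3 ≃ₗᵢ[ℝ] E3 := halfTurn.trans (LinearIsometryEquiv.neg ℝ)

/-- Pointwise formula of the basal reflection: `-(halfTurn v)`. -/
theorem basalRefl_apply (v : E3) : basalRefl v = -halfTurn v := rfl

/-- The basal reflection is an involution. -/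
theorem basalRefl_basalRefl (v : E3) : basalRefl (basalRefl v) = v := by
  rw [basalRefl_apply, basalRefl_apply, map_neg, halfTurn_halfTurn, neg_neg]

/-- The basal reflection is its own inverse. -/
theorem basalRefl_symm : basalRefl.symm = basalRefl := by
  refine LinearIsometryEquiv.ext (fun v => ?_)
  apply basalRefl.injective
  rw [LinearIsometryEquiv.apply_symm_apply, basalRefl_basalRefl]

/-- The basal reflection negates the axial coordinate `Σx`. -/
theorem axSumL_basalRefl (v : E3) : axSumL (basalRefl v) = -axSumL v := by
  rw [basalRefl_apply, map_neg, axSumL_halfTurn]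

end

end Summit.AtomisticToContinuum.Crystallization.Theorems.OverbindingBudgetAffineFarFieldCellTwist
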